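import Literature.Probability.Percolation.ArmSeparationOutKeysFour
import Literature.Probability.Percolation.ArmSeparationExtSlotArith
import Literature.Probability.Percolation.AdjLaneCut
import HarnessLib

/-!
# Ring objects read through the rotations: keys, windows and their order

Topic `Literature/Probability/Percolation`; family `crit-perc` / near-critical percolation on `𝕋`.
A brick of the near-critical arm-separation theorem for four arms in the ADJACENT colour
arrangement (P. Nolin, *Near-critical percolation in two dimensions*, EJP 13 (2008), Thm. 11 for
`j = 4`, `σ = BBWW` [arXiv 0711.4948: Thm. 10], landing step, §4.4 with Prop. 12 (i)); the input
`hsepAdj` of `Werner2009_lemma63_of_altSeparation_of_adjSeparation`.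

This is the companion of `ArmSeparationOutKeysFour.lean` for objects whose sides are all read through
the ROTATIONS `ρ^i` (`triRotIsoPow i`) of the frame `0` — the setting of the adjacent arrangement, where
the exits and the targets are landed by pure rotations (`AdjDuoLanding.lean`). Read this way every
side is oriented alike: the perimeter key of the row `ξ` of the side `i` is `Lanes.rotKey M i ξ =
2Mi + ξ + 2M` (increasing in the row on every side, `AdjLaneCut.lean`) and the ring position of the
piece of lateral index `ι` of the side `i` is `extPos n i ι = blockOff n i + 2ι`
(`ArmSeparationExtSlotArith.lean`), so that none of the reflected branches of the alternating case
occur. We prove, for the objects `RingObj` (side, row interval) of `ArmSeparationOutKeysFour.lean` read this way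
(declarations prefixed `r`/`R`, next to the reflected readings of that file):

* the window `rwlo/rwhi` on a ring and `rwindow_mem_block`, `extPos_mem_rwindow`;
* the side-lexicographic order `RBefore g s` and `rwhi_lt_rwlo_of_rbefore` (`g = 3`); the cut position
  `rcutPos` and `rwhi_lt_rcutPos`, `rcutPos_lt_rwlo` (`g = 2`);
* `rbefore_of_rotKey_lt` / `rotKey_lt_of_rbefore` — the key order of representative rows is the
  side-lexicographic order (for separated objects, `RingObj.Sep`);
* `linPos_rwindow`, **`rot_linPos_lt_of_cyc_lt`** — the anticlockwise key order from the cut key gives the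
  order of the windows read from the cut position.

The object type `RingObj`, its range predicate `RingObj.OK` (with `OK.idx`) and the separation
`RingObj.Sep` are those of `ArmSeparationOutKeysFour.lean`.

Everything here is proved; no named facts are introduced.

## References

* P. Nolin, Near-critical percolation in two dimensions, *Electron. J. Probab.* 13 (2008), §4.3
  Prop. 12 (i), §4.4 (arXiv 0711.4948: Prop. 11; proof of Thm. 10, p. 12) [Nolin2008].
* H. Kesten, Scaling relations for 2D-percolation, *Comm. Math. Phys.* 109 (1987), Lemma 2 [Kesten1987].

Tree: `extPos`, `extPos_mem_block`, `blockOff`, `blockEnd`, `blockEnd_le_blockOff`, `latIdx`,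
`latIdx_spec`, `latIdx_mono`, `lat_gap_le`, `Lanes.rotKey`, `Lanes.cyc`, `linPos`.
-/

namespace Literature.Probability.Percolation

open Lanes

/-! ### Keys read through the rotations -/

/-- **Keys of interior rows lie strictly inside the block of their side**:
`2Mi < rotKey M i ξ < 2M(i+1)` for `-2M < ξ < 0`. [folklore] -/
theorem Lanes.rotKey_mem_block {M i : ℕ} {ξ : ℤ} (h1 : -(2 * (M : ℤ)) < ξ) (h2 : ξ < 0) :
    2 * (M : ℤ) * i < rotKey M i ξ ∧ rotKey M i ξ < 2 * (M : ℤ) * (i + 1) := by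
  unfold rotKey; constructor <;> linarith

/-! ### Windows read through the rotations -/

namespace RingObj

variable (n s r : ℕ) (X : RingObj)

/-- first position of the window of `X` READ THROUGH THE ROTATION of its side, on the ring with `n` chunks of length `s`, radius `r = n s`:
the pieces of lateral indices `latIdx lo - 1, …, latIdx hi + 1` of the side `fr` and their connectors [folklore] -/
def rwlo : ℕ := extPos n X.fr (latIdx s r X.lo - 1)
/-- last position of the window [folklore] -/
def rwhi : ℕ := extPos n X.fr (latIdx s r X.hi + 1) + 1

variable {n s r X}

/-- The window lies in the block of its side, inside the ring, with one position of margin at the top: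
`blockOff ≤ rwlo ≤ rwhi`, `rwhi + 1 < blockEnd ≤ 12n - 4`. [folklore] -/
theorem rwindow_mem_block {M : ℕ} (hX : X.OK s r M) (hs : 1 ≤ s) (hns : (n : ℤ) * s = r) :
    blockOff n X.fr ≤ X.rwlo n s r ∧ X.rwlo n s r ≤ X.rwhi n s r ∧ X.rwhi n s r + 1 < blockEnd n X.fr ∧
      blockEnd n X.fr ≤ 12 * n - 4 := by
  obtain ⟨i1, i2, i3⟩ := hX.idx hs hns
  have hfr := hX.hfr
  have hn : 1 ≤ n := by omega
  have hend : blockEnd n X.fr ≤ 12 * n - 4 := by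
    generalize X.fr = f at hfr
    interval_cases f <;> simp only [blockEnd] <;> omega
  have p1 := extPos_mem_block (n := n) (i := X.fr) hn hfr (show latIdx s r X.lo - 1 < n by omega)
  have p3 := extPos_mem_block (n := n) (i := X.fr) hn hfr (show latIdx s r X.hi + 2 < n by omega)
  unfold extPos at p1 p3
  refine ⟨?_, ?_, ?_, hend⟩
  · unfold rwlo extPos; exact p1.1
  · unfold rwlo rwhi extPos; omega
  · unfold rwhi extPos; omega

/-- **A row of the object gives a piece of its window**: for a lateral index `ι` with
`latIdx lo - 1 ≤ ι ≤ latIdx hi + 1` the piece `extPos n fr ι` (and its successor position) lies in `[rwlo, rwhi]`. [folklore] -/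
theorem extPos_mem_rwindow {ι : ℕ} (h1 : latIdx s r X.lo - 1 ≤ ι) (h2 : ι ≤ latIdx s r X.hi + 1) :
    X.rwlo n s r ≤ extPos n X.fr ι ∧ extPos n X.fr ι + 1 ≤ X.rwhi n s r := by
  unfold rwlo rwhi extPos; omega

/-! ### Order of objects and of their windows -/

/-- **Side-lexicographic order with a gap of `g` chunks**: `X` is before `Y` if its side is smaller,
or on a common side its rows are at least `g` chunks below those of `Y`. [folklore] -/
def RBefore (g s : ℕ) (X Y : RingObj) : Prop := X.fr < Y.fr ∨ (X.fr = Y.fr ∧ X.hi + g * s ≤ Y.lo)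

/-- **The windows of ordered objects are ordered**: `rwhi X < rwlo Y` when `X` is three chunks before `Y`. [folklore] -/
theorem rwhi_lt_rwlo_of_rbefore {M : ℕ} {Y : RingObj} (hX : X.OK s r M) (hY : Y.OK s r M) (hs : 1 ≤ s)
    (hns : (n : ℤ) * s = r) (h : RBefore 3 s X Y) : X.rwhi n s r < Y.rwlo n s r := by
  obtain ⟨x1, x2, x3⟩ := hX.idx hs hns
  obtain ⟨y1, y2, y3⟩ := hY.idx hs hns
  have hn : 1 ≤ n := by omega
  rcases h with h | ⟨hfe, hA⟩
  · -- different sides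
    obtain ⟨-, -, bx, -⟩ := rwindow_mem_block (n := n) hX hs hns
    obtain ⟨byo, -⟩ := rwindow_mem_block (n := n) hY hs hns
    have := blockEnd_le_blockOff (n := n) h hY.hfr
    omega
  · -- common side
    have hs0 : 0 < s := hs
    have hMr : (2 * M : ℤ) ≤ r := by exact_mod_cast hX.hMr
    have hr1 : -(r : ℤ) ≤ X.lo := by linarith [hX.hlo, (show (0 : ℤ) ≤ s from by positivity)]
    have hr2 : -(r : ℤ) ≤ Y.lo := by linarith [hY.hlo, (show (0 : ℤ) ≤ s from by positivity)]
    have hXhi := latIdx_spec (s := s) (r := r) hs (le_trans hr1 hX.hlohi)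
    have hYlo := latIdx_spec (s := s) (r := r) hs hr2
    have hgap : latIdx s r X.hi + 3 ≤ latIdx s r Y.lo :=
      lat_gap_le (c := 3) hs0 hXhi.1 hYlo.2 (by push_cast at hA ⊢; linarith)
    unfold rwhi rwlo extPos
    rw [← hfe]
    omega

/-- **The cut position**: the piece of the lowest row of the cut object. [folklore] -/
def rcutPos (n' s' r' : ℕ) (C : RingObj) : ℕ := extPos n' C.fr (latIdx s' r' C.lo)

/-- The cut position lies in the window of the cut object (hence inside the ring). [folklore] -/
theorem rwlo_le_rcutPos {M : ℕ} (hC : X.OK s r M) (hs : 1 ≤ s) (hns : (n : ℤ) * s = r) :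
    X.rwlo n s r ≤ X.rcutPos n s r ∧ X.rcutPos n s r + 1 ≤ X.rwhi n s r := by
  obtain ⟨-, x2, -⟩ := hC.idx hs hns
  exact extPos_mem_rwindow (by omega) (by omega)

/-- **An object two chunks before the cut has its window before the cut position.** [folklore] -/
theorem rwhi_lt_rcutPos {M : ℕ} {C : RingObj} (hX : X.OK s r M) (hC : C.OK s r M) (hs : 1 ≤ s)
    (hns : (n : ℤ) * s = r) (h : RBefore 2 s X C) : X.rwhi n s r < C.rcutPos n s r := by
  obtain ⟨x1, x2, x3⟩ := hX.idx hs hns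
  obtain ⟨y1, y2, y3⟩ := hC.idx hs hns
  have hn : 1 ≤ n := by omega
  rcases h with h | ⟨hfe, hA⟩
  · obtain ⟨-, -, bx, -⟩ := rwindow_mem_block (n := n) hX hs hns
    obtain ⟨byo, -⟩ := rwindow_mem_block (n := n) hC hs hns
    have := blockEnd_le_blockOff (n := n) h hC.hfr
    have := (rwlo_le_rcutPos (n := n) hC hs hns).1
    omega
  · have hs0 : 0 < s := hs
    have hMr : (2 * M : ℤ) ≤ r := by exact_mod_cast hX.hMr
    have hr1 : -(r : ℤ) ≤ X.lo := by linarith [hX.hlo, (show (0 : ℤ) ≤ s from by positivity)]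
    have hr2 : -(r : ℤ) ≤ C.lo := by linarith [hC.hlo, (show (0 : ℤ) ≤ s from by positivity)]
    have hXhi := latIdx_spec (s := s) (r := r) hs (le_trans hr1 hX.hlohi)
    have hClo := latIdx_spec (s := s) (r := r) hs hr2
    have hgap : latIdx s r X.hi + 2 ≤ latIdx s r C.lo :=
      lat_gap_le (c := 2) hs0 hXhi.1 hClo.2 (by push_cast at hA ⊢; linarith)
    unfold rwhi rcutPos extPos
    rw [← hfe]
    omega

/-- **An object two chunks after the cut has its window after the cut position.** [folklore] -/
theorem rcutPos_lt_rwlo {M : ℕ} {C : RingObj} (hX : X.OK s r M) (hC : C.OK s r M) (hs : 1 ≤ s)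
    (hns : (n : ℤ) * s = r) (h : RBefore 2 s C X) : C.rcutPos n s r < X.rwlo n s r := by
  obtain ⟨x1, x2, x3⟩ := hX.idx hs hns
  obtain ⟨y1, y2, y3⟩ := hC.idx hs hns
  have hn : 1 ≤ n := by omega
  rcases h with h | ⟨hfe, hA⟩
  · obtain ⟨bxo, -⟩ := rwindow_mem_block (n := n) hX hs hns
    obtain ⟨-, -, bc, -⟩ := rwindow_mem_block (n := n) hC hs hns
    have := blockEnd_le_blockOff (n := n) h hX.hfr
    have := (rwlo_le_rcutPos (n := n) hC hs hns).2
    omega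
  · have hs0 : 0 < s := hs
    have hMr : (2 * M : ℤ) ≤ r := by exact_mod_cast hX.hMr
    have hr1 : -(r : ℤ) ≤ X.lo := by linarith [hX.hlo, (show (0 : ℤ) ≤ s from by positivity)]
    have hr2 : -(r : ℤ) ≤ C.lo := by linarith [hC.hlo, (show (0 : ℤ) ≤ s from by positivity)]
    have hChi := latIdx_spec (s := s) (r := r) hs (le_trans hr2 hC.hlohi)
    have hXlo := latIdx_spec (s := s) (r := r) hs hr1
    have hgap : latIdx s r C.hi + 2 ≤ latIdx s r X.lo :=
      lat_gap_le (c := 2) hs0 hChi.1 hXlo.2 (by push_cast at hA ⊢; linarith)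
    have hlohi := latIdx_mono (s := s) (r := r) hC.hlohi
    unfold rwlo rcutPos extPos
    rw [hfe]
    omega

/-- **Key order of representative rows gives the side-lexicographic order**: for rows `ρX ∈ [lo X, hi X]`,
`ρY ∈ [lo Y, hi Y]` of separated objects in range with `rotKey (fr X) ρX < rotKey (fr Y) ρY`, `X` is
before `Y`. [folklore] -/
theorem rbefore_of_rotKey_lt {M : ℕ} {Y : RingObj} (hX : X.OK s r M) (hY : Y.OK s r M) (hs : 1 ≤ s) (hsep : Sep s X Y)
    {ρX ρY : ℤ} (hρX : X.lo ≤ ρX ∧ ρX ≤ X.hi) (hρY : Y.lo ≤ ρY ∧ ρY ≤ Y.hi)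
    (hlt : rotKey M X.fr ρX < rotKey M Y.fr ρY) : RBefore 3 s X Y := by
  have hs0 : (1 : ℤ) ≤ s := by exact_mod_cast hs
  have bx := rotKey_mem_block (M := M) (i := X.fr) (ξ := ρX) (by linarith [hX.hlo, hρX.1]) (by linarith [hX.hhi, hρX.2])
  have by' := rotKey_mem_block (M := M) (i := Y.fr) (ξ := ρY) (by linarith [hY.hlo, hρY.1]) (by linarith [hY.hhi, hρY.2])
  rcases lt_trichotomy X.fr Y.fr with h | h | h
  · exact Or.inl h
  · right
    have hor : ρX < ρY := (rotKey_lt_rotKey_iff (M := M) (i := X.fr)).1 (by rw [h] at hlt ⊢; exact hlt)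
    refine ⟨h, ?_⟩
    rcases hsep h with hs' | hs'
    · exact_mod_cast hs'
    · exfalso; linarith [hρX.1, hρY.2]
  · exfalso
    have h1 : (Y.fr : ℤ) + 1 ≤ X.fr := by exact_mod_cast h
    have hM : (0 : ℤ) ≤ M := by positivity
    nlinarith [bx.1, by'.2]

/-- **The side-lexicographic order (gap `g ≥ 1`) gives the key order** of all rows, with a gap of a chunk. [folklore] -/
theorem rotKey_lt_of_rbefore {M g : ℕ} {Y : RingObj} (hX : X.OK s r M) (hY : Y.OK s r M) (hs : 1 ≤ s) (hg : 1 ≤ g)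
    (h : RBefore g s X Y) {ρX ρY : ℤ} (hρX : X.lo ≤ ρX ∧ ρX ≤ X.hi) (hρY : Y.lo ≤ ρY ∧ ρY ≤ Y.hi) :
    rotKey M X.fr ρX + s ≤ rotKey M Y.fr ρY := by
  have hs0 : (1 : ℤ) ≤ s := by exact_mod_cast hs
  have hgs : (s : ℤ) ≤ (g : ℤ) * s := le_mul_of_one_le_left (by positivity) (by exact_mod_cast hg)
  have by' := rotKey_mem_block (M := M) (i := Y.fr) (ξ := ρY) (by linarith [hY.hlo, hρY.1]) (by linarith [hY.hhi, hρY.2])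
  rcases h with h | ⟨hfe, hA⟩
  · -- different blocks; the key of `ρX` is at least `s` below the end of its block
    have h1 : (X.fr : ℤ) + 1 ≤ Y.fr := by exact_mod_cast h
    have hM : (0 : ℤ) ≤ M := by positivity
    have hend : rotKey M X.fr ρX + s ≤ 2 * (M : ℤ) * (X.fr + 1) := by
      unfold rotKey; linarith [hρX.2, hX.hhi]
    nlinarith [by'.1]
  · unfold rotKey
    rw [← hfe]
    linarith [hρX.2, hρY.1]

/-! ### Reading positions from a cut -/

/-- **Read positions are monotone along a window off the cut**: for an object two chunks before or after
the cut object `C` and a position `p` of its window, `linPos (rwlo) ≤ linPos p ≤ linPos (rwhi)` (read from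
the cut position of `C` on the ring `G = 12n - 4`). [folklore] -/
theorem linPos_rwindow {M : ℕ} {C : RingObj} (hX : X.OK s r M) (hC : C.OK s r M) (hs : 1 ≤ s) (hns : (n : ℤ) * s = r)
    (hXC : RBefore 2 s X C ∨ RBefore 2 s C X) {p : ℕ} (hp : X.rwlo n s r ≤ p ∧ p ≤ X.rwhi n s r) :
    linPos (12 * n - 4) (C.rcutPos n s r) (X.rwlo n s r) ≤ linPos (12 * n - 4) (C.rcutPos n s r) p ∧
      linPos (12 * n - 4) (C.rcutPos n s r) p ≤ linPos (12 * n - 4) (C.rcutPos n s r) (X.rwhi n s r) := by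
  obtain ⟨-, wx, bx, ex⟩ := rwindow_mem_block (n := n) hX hs hns
  obtain ⟨-, -, bc, ec⟩ := rwindow_mem_block (n := n) hC hs hns
  have hpc := (rwlo_le_rcutPos (n := n) hC hs hns).2
  have hpcG : C.rcutPos n s r < 12 * n - 4 := by omega
  rcases hXC with h | h
  · have w := rwhi_lt_rcutPos (n := n) hX hC hs hns h
    rw [linPos_of_lt hpcG (by omega), linPos_of_lt hpcG (by omega), linPos_of_lt hpcG w]
    omega
  · have w := rcutPos_lt_rwlo (n := n) hX hC hs hns h
    rw [linPos_of_ge (by omega) (by omega), linPos_of_ge (by omega) (by omega), linPos_of_ge (by omega) (by omega)]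
    omega

/-- **From the perimeter order to the ring order.** Let `C` be a cut object in range; let `X`, `Y` be
objects in range, each two chunks before or after the cut, separated from each other, with
representative rows `ρX`, `ρY` whose keys are in the anticlockwise order
`cyc P c (rotKey X ρX) < cyc P c (rotKey Y ρY)` from the key `c` of the cut row `C.lo` (`P >` the key of `Y`).
Then the window of `X` read from the cut position ends before the window of `Y` begins:
`linPos G pc (rwhi X) < linPos G pc (rwlo Y)` (`G = 12n - 4`, `pc = rcutPos C`). [cite: Nolin2008, §4.3 Prop. 12 (i) (arXiv 0711.4948: Prop. 11; relocation of landing areas)] -/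
theorem rot_linPos_lt_of_cyc_lt {M : ℕ} {Y C : RingObj} (hX : X.OK s r M) (hY : Y.OK s r M) (hC : C.OK s r M) (hs : 1 ≤ s)
    (hns : (n : ℤ) * s = r) (hsep : Sep s X Y) (hXC : RBefore 2 s X C ∨ RBefore 2 s C X)
    (hYC : RBefore 2 s Y C ∨ RBefore 2 s C Y) {ρX ρY : ℤ} (hρX : X.lo ≤ ρX ∧ ρX ≤ X.hi) (hρY : Y.lo ≤ ρY ∧ ρY ≤ Y.hi)
    {P : ℤ} (hPY : rotKey M Y.fr ρY < P)
    (hlt : cyc P (rotKey M C.fr C.lo) (rotKey M X.fr ρX) < cyc P (rotKey M C.fr C.lo) (rotKey M Y.fr ρY)) :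
    linPos (12 * n - 4) (C.rcutPos n s r) (X.rwhi n s r) < linPos (12 * n - 4) (C.rcutPos n s r) (Y.rwlo n s r) := by
  obtain ⟨-, wx, bx, ex⟩ := rwindow_mem_block (n := n) hX hs hns
  obtain ⟨-, wy, byy, ey⟩ := rwindow_mem_block (n := n) hY hs hns
  obtain ⟨-, -, bc, ec⟩ := rwindow_mem_block (n := n) hC hs hns
  have hpc := (rwlo_le_rcutPos (n := n) hC hs hns).2
  set pc := C.rcutPos n s r with hpcdef
  have hpcG : pc < 12 * n - 4 := by omega
  have hxG : X.rwhi n s r < 12 * n - 4 := by omega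
  have hyG : Y.rwlo n s r < 12 * n - 4 := by omega
  have hρC : C.lo ≤ C.lo ∧ C.lo ≤ C.hi := ⟨le_rfl, hC.hlohi⟩
  -- key consequences of the positions relative to the cut
  have hs1 : (1 : ℤ) ≤ s := by exact_mod_cast hs
  have kXC : RBefore 2 s X C → rotKey M X.fr ρX < rotKey M C.fr C.lo := fun h => by
    have h1 := rotKey_lt_of_rbefore (M := M) hX hC hs (by norm_num) h hρX hρC
    linarith
  have kCX : RBefore 2 s C X → rotKey M C.fr C.lo < rotKey M X.fr ρX := fun h => by
    have h1 := rotKey_lt_of_rbefore (M := M) hC hX hs (by norm_num) h hρC hρX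
    linarith
  have kYC : RBefore 2 s Y C → rotKey M Y.fr ρY < rotKey M C.fr C.lo := fun h => by
    have h1 := rotKey_lt_of_rbefore (M := M) hY hC hs (by norm_num) h hρY hρC
    linarith
  have kCY : RBefore 2 s C Y → rotKey M C.fr C.lo < rotKey M Y.fr ρY := fun h => by
    have h1 := rotKey_lt_of_rbefore (M := M) hC hY hs (by norm_num) h hρC hρY
    linarith
  -- window consequences
  have wXC : RBefore 2 s X C → X.rwhi n s r < pc := fun h => rwhi_lt_rcutPos (n := n) hX hC hs hns h
  have wCX : RBefore 2 s C X → pc < X.rwlo n s r := fun h => rcutPos_lt_rwlo (n := n) hX hC hs hns h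
  have wYC : RBefore 2 s Y C → Y.rwhi n s r < pc := fun h => rwhi_lt_rcutPos (n := n) hY hC hs hns h
  have wCY : RBefore 2 s C Y → pc < Y.rwlo n s r := fun h => rcutPos_lt_rwlo (n := n) hY hC hs hns h
  have hs0 : (0 : ℤ) ≤ s := by positivity
  have bX := rotKey_mem_block (M := M) (i := X.fr) (ξ := ρX) (by linarith [hX.hlo, hρX.1]) (by linarith [hX.hhi, hρX.2])
  have bY := rotKey_mem_block (M := M) (i := Y.fr) (ξ := ρY) (by linarith [hY.hlo, hρY.1]) (by linarith [hY.hhi, hρY.2])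
  have hX0 : (0 : ℤ) ≤ 2 * (M : ℤ) * X.fr := by positivity
  have hY0 : (0 : ℤ) ≤ 2 * (M : ℤ) * Y.fr := by positivity
  rcases hXC with hXC | hXC <;> rcases hYC with hYC | hYC
  · -- both before the cut: keys below `c`, same branch of `cyc`
    have k1 := kXC hXC; have k2 := kYC hYC
    have w1 := wXC hXC; have w2 := wYC hYC
    have hk : rotKey M X.fr ρX < rotKey M Y.fr ρY := by unfold cyc at hlt; split_ifs at hlt <;> omega
    have hw := rwhi_lt_rwlo_of_rbefore (n := n) hX hY hs hns (rbefore_of_rotKey_lt (M := M) hX hY hs hsep hρX hρY hk)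
    rw [linPos_of_lt hpcG w1, linPos_of_lt hpcG (by omega : Y.rwlo n s r < pc)]
    omega
  · -- `X` before the cut, `Y` after: excluded by the cyclic order
    exfalso
    have k1 := kXC hXC; have k2 := kCY hYC
    unfold cyc at hlt; split_ifs at hlt <;> omega
  · -- `X` after the cut, `Y` before: `X` reads small, `Y` reads large
    have w1 := wCX hXC; have w2 := wYC hYC
    rw [linPos_of_ge hxG (by omega), linPos_of_lt hpcG (by omega)]
    omega
  · -- both after the cut
    have k1 := kCX hXC; have k2 := kCY hYC
    have w1 := wCX hXC; have w2 := wCY hYC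
    have hk : rotKey M X.fr ρX < rotKey M Y.fr ρY := by unfold cyc at hlt; split_ifs at hlt <;> omega
    have hw := rwhi_lt_rwlo_of_rbefore (n := n) hX hY hs hns (rbefore_of_rotKey_lt (M := M) hX hY hs hsep hρX hρY hk)
    rw [linPos_of_ge hxG (by omega), linPos_of_ge hyG (by omega)]
    omega

end RingObj

end Literature.Probability.Percolation
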